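import Summits.Ventures.PackingBounds.ThreePointCert.C9TCert

/-!
# A(9, arccos 1/3) ≤ 99 (three-point bound, kernel-checked): kernel validation of Gram block R0 (chunks 1–4 of 8)

Framing: lottery ticket; floor = certified bounds/negative ranges. Venture `PackingBounds` (cell
`pub-packcert`), three-point SDP family. Integer data of a feasible point of the Bachoc–Vallentin
semidefinite program (n = 9, s = 1/3, degree d = 8, symmetric
sums of squares), derived by `pub-packcert-sdp/code/cert2lean.py` from the exact rational
certificate `sdp-n9-d8-s1-3-sym.json` of the cell (two independent exact verifiers + referee), in the
units of the kernel checker `ThreePointCert.Check` (soundness `ThreePointCert.Sound`). Generated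
file: plain lists of integers / monomials.
-/

namespace Summit.Ventures.PackingBounds.ThreePointCert.C9T

open Literature.Geometry.DiscreteGeometry Literature.Geometry.DiscreteGeometry.PolyCert PolyCert.SPoly

set_option maxHeartbeats 0 in
/-- Block `R0`: rows from 0 (51 rows) of `zᵀ(LLᵀ)z` added to `[]` give `dR0c1` (kernel). -/
theorem okR0_1 : chunkOK gR0 0 51 [] dR0c1 = true := by
  decide +kernel

set_option maxHeartbeats 0 in
/-- Block `R0`: rows from 51 (23 rows) of `zᵀ(LLᵀ)z` added to `dR0c1` give `dR0c2` (kernel). -/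
theorem okR0_2 : chunkOK gR0 51 23 dR0c1 dR0c2 = true := by
  decide +kernel

set_option maxHeartbeats 0 in
/-- Block `R0`: rows from 74 (19 rows) of `zᵀ(LLᵀ)z` added to `dR0c2` give `dR0c3` (kernel). -/
theorem okR0_3 : chunkOK gR0 74 19 dR0c2 dR0c3 = true := by
  decide +kernel

set_option maxHeartbeats 0 in
/-- Block `R0`: rows from 93 (17 rows) of `zᵀ(LLᵀ)z` added to `dR0c3` give `dR0c4` (kernel). -/
theorem okR0_4 : chunkOK gR0 93 17 dR0c3 dR0c4 = true := by
  decide +kernel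

end Summit.Ventures.PackingBounds.ThreePointCert.C9T
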